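import Summits.AnomalousDissipation.AnomalousDissipation.Theorems.CoherentFractionInvariantExtremeClimatesPlanar.Negative.OrbitClimate
import HarnessLib

/-!
# Probe functionals for the orbit climate (negative lane of
# `CoherentFraction.InvariantExtremeClimatesPlanar`, stmt-AnomalousDissipation-28074, block C1)

Cylindrical test functionals `Φ_{j,l,w}` (four Stokes-mode coordinates with amplitude `e₁` and
frequencies `∓(2,0,0)`, `∓(0,0,1)`; scalar function `y ↦ χ(y) Re(w (y₀ + i y₁)^{[j]} (y₂ + i y₃)^{[l]})`,
`z^{[n]} = z^n` (`n ≥ 0`), `= z̄^{|n|}` (`n < 0`), `χ` a bump `≡ 1` on the coordinate range of the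
orbit) whose value along the orbit of the crossed-shear root is the character
`Φ_{j,l,w}(orb σ) = Re(w Γ_{j,l} e_{(2j,l)}(σ))`, `Γ_{j,l} = 2^{-|j|} (c_K/4)^{|l|} ≠ 0`
(`𝓕v₁(2,0,0) = ½`, `𝓕v₁(0,0,1) = c_K/4`), and the resulting formula for the drift pairing
`(orb σ, (h·∇)Φ'_{j,l,w}(orb σ)) = -Re(w Γ e_{(2j,l)}(σ) · 2πi (2j h₀ + l h₂))`. [folklore]
-/

noncomputable section

set_option linter.dupNamespace false

namespace Summit.AnomalousDissipation.AnomalousDissipation.Theorems.CrossedShearOrbit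

open Real MeasureTheory Filter Topology Set
open scoped InnerProductSpace ENNReal ComplexConjugate
open Literature.Analysis.FunctionSpaces Literature.Analysis.FunctionSpaces.Torus Literature.Analysis.FluidPDE
open Literature.Analysis.FluidPDE.Torus
open Summit.AnomalousDissipation.AnomalousDissipation.Theorems.CrossedShearRoot
open UnitAddTorus (mFourier mFourierCoeff)

local notation "𝕋³" => UnitAddTorus (Fin 3)
local notation "𝕋²" => UnitAddTorus (Fin 2)
local notation "E³" => EuclideanSpace ℝ (Fin 3)
local notation "E²" => EuclideanSpace ℝ (Fin 2)
local notation "E⁴" => EuclideanSpace ℝ (Fin 4)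

/-! ## Probe fields -/

/-- First probe frequency `-(2,0,0)`. [folklore] -/
def kA : Fin 3 → ℤ := ![-2, 0, 0]

/-- Second probe frequency `-(0,0,1)`. [folklore] -/
def kB : Fin 3 → ℤ := ![0, 0, -1]

/-- The amplitude `e₁`. [folklore] -/
def e1v : E³ := EuclideanSpace.single (1 : Fin 3) (1 : ℝ)

/-- `kA ≠ 0`. [folklore] -/
theorem kA_ne_zero : kA ≠ 0 := by decide

/-- `kB ≠ 0`. [folklore] -/
theorem kB_ne_zero : kB ≠ 0 := by decide

/-- `-kA = (2,0,0)`. [folklore] -/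
theorem neg_kA : -kA = ![2, 0, 0] := by decide

/-- `-kB = (0,0,1)`. [folklore] -/
theorem neg_kB : -kB = ![0, 0, 1] := by decide

/-- Horizontal frequencies are orthogonal to `e₁`. [folklore] -/
theorem inner_latticeVec_e1v {k : Fin 3 → ℤ} (hk : k 1 = 0) : ⟪latticeVec k, e1v⟫_ℝ = 0 := by
  simp [e1v, EuclideanSpace.inner_single_right, hk]

/-- The four probe frequencies. [folklore] -/
def probeK : Fin 4 → (Fin 3 → ℤ) := ![kA, kA, kB, kB]

/-- The four probe phases (`true` = cosine part, `false` = sine part). [folklore] -/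
def probeC : Fin 4 → Bool := ![true, false, true, false]

/-- The probe frequencies are nonzero. [folklore] -/
theorem probeK_ne_zero (i : Fin 4) : probeK i ≠ 0 := by
  fin_cases i <;> decide

/-- The probe frequencies are horizontal. [folklore] -/
theorem probeK_apply_one (i : Fin 4) : probeK i 1 = 0 := by
  fin_cases i <;> rfl

/-- The probe fields `gᵢ = stokesMode kᵢ e₁ cᵢ`. [folklore] -/
def probeField (i : Fin 4) : 𝕋³ → E³ := ⇑(stokesMode (probeK i) e1v (probeC i))

/-- The probe coordinates `u ↦ ((u, g₀), …, (u, g₃))`. [folklore] -/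
def probeCoords (u : energySpace (Fin 3)) : E⁴ :=
  WithLp.toLp 2 fun i => pairing (u : Lp E³ 2 (volume : Measure 𝕋³)) (probeField i)

/-- The probe coordinates are continuous on `H`. [folklore] -/
theorem continuous_probeCoords : Continuous probeCoords :=
  (PiLp.continuous_toLp 2 _).comp
    (continuous_pi fun i => continuous_pairing_coe ((isSmooth_stokesMode (probeK i) e1v (probeC i)).memLp 2))

/-- A bound for the probe coordinates along the orbit. [folklore] -/
def Mco : ℝ := sSup (Set.range fun σ : 𝕋² => ‖probeCoords (orb σ)‖)

/-- `‖coords(orb σ)‖ ≤ M`. [folklore] -/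
theorem norm_probeCoords_orb_le (σ : 𝕋²) : ‖probeCoords (orb σ)‖ ≤ Mco :=
  le_csSup (isCompact_range ((continuous_probeCoords.comp continuous_orb).norm)).bddAbove ⟨σ, rfl⟩

/-- `0 ≤ M`. [folklore] -/
theorem Mco_nonneg : 0 ≤ Mco := (norm_nonneg _).trans (norm_probeCoords_orb_le 0)

/-- The cutoff: a smooth bump `≡ 1` on the ball of radius `M + 1`. [folklore] -/
def cutoff : ContDiffBump (0 : E⁴) := ⟨Mco + 1, Mco + 2, by linarith [Mco_nonneg], by linarith⟩

/-- The cutoff is `1` at the probe coordinates of every orbit state. [folklore] -/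
theorem cutoff_probeCoords_orb (σ : 𝕋²) : (cutoff : E⁴ → ℝ) (probeCoords (orb σ)) = 1 :=
  cutoff.one_of_mem_closedBall (by
    rw [Metric.mem_closedBall, dist_zero_right]
    show _ ≤ Mco + 1
    linarith [norm_probeCoords_orb_le σ])

/-! ## The scalar test function -/

/-- Signed power: `z^{[n]} = z^n` for `n ≥ 0` and `z̄^{|n|}` for `n < 0`. [folklore] -/
def spow (z : ℂ) (n : ℤ) : ℂ := (if 0 ≤ n then z else conj z) ^ n.natAbs

/-- The probe polynomial `(y₀ + i y₁)^{[j]} (y₂ + i y₃)^{[l]}`. [folklore] -/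
def Gpoly (j l : ℤ) (y : E⁴) : ℂ :=
  spow ((y 0 : ℂ) + (y 1 : ℂ) * Complex.I) j * spow ((y 2 : ℂ) + (y 3 : ℂ) * Complex.I) l

/-- The scalar test function `χ(y) Re(w G_{j,l}(y))`. [folklore] -/
def probeFun (j l : ℤ) (w : ℂ) (y : E⁴) : ℝ := (cutoff : E⁴ → ℝ) y * (w * Gpoly j l y).re

/-- Coordinates are smooth (as complex numbers). [folklore] -/
theorem contDiff_coordC (i : Fin 4) : ContDiff ℝ (⊤ : ℕ∞) fun y : E⁴ => (y i : ℂ) :=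
  Complex.ofRealCLM.contDiff.comp (PiLp.proj (𝕜 := ℝ) 2 (fun _ : Fin 4 => ℝ) i).contDiff

/-- Signed powers of smooth functions are smooth. [folklore] -/
theorem contDiff_spow_comp {f : E⁴ → ℂ} (hf : ContDiff ℝ (⊤ : ℕ∞) f) (n : ℤ) :
    ContDiff ℝ (⊤ : ℕ∞) fun y => spow (f y) n := by
  unfold spow
  split_ifs
  · exact hf.pow _
  · exact (Complex.conjCLE.contDiff.comp hf).pow _

/-- The probe polynomial is smooth. [folklore] -/
theorem contDiff_Gpoly (j l : ℤ) : ContDiff ℝ (⊤ : ℕ∞) (Gpoly j l) :=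
  (contDiff_spow_comp ((contDiff_coordC 0).add ((contDiff_coordC 1).mul contDiff_const)) j).mul
    (contDiff_spow_comp ((contDiff_coordC 2).add ((contDiff_coordC 3).mul contDiff_const)) l)

/-- The scalar test function is `C¹`. [folklore] -/
theorem contDiff_probeFun (j l : ℤ) (w : ℂ) : ContDiff ℝ 1 (probeFun j l w) :=
  ((cutoff.contDiff (n := (⊤ : ℕ∞))).mul
    (Complex.reCLM.contDiff.comp (contDiff_const.mul (contDiff_Gpoly j l)))).of_le
    (WithTop.coe_le_coe.2 le_top)

/-- The scalar test function has compact support. [folklore] -/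
theorem hasCompactSupport_probeFun (j l : ℤ) (w : ℂ) : HasCompactSupport (probeFun j l w) :=
  cutoff.hasCompactSupport.mul_right

/-- **The probe functional** `Φ_{j,l,w}`. [folklore] -/
def probe (j l : ℤ) (w : ℂ) : CylindricalTest (Fin 3) where
  m := 4
  g := probeField
  g_smooth i := isSmooth_stokesMode (probeK i) e1v (probeC i)
  g_divFree i := isDivFree_stokesMode (inner_latticeVec_e1v (probeK_apply_one i)) _
  g_zeroMean i := hasZeroMean_stokesMode (probeK_ne_zero i) _ _
  φ := probeFun j l w
  φ_contDiff := contDiff_probeFun j l w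
  φ_compact := hasCompactSupport_probeFun j l w

/-- The coordinates of the probe functional are the probe coordinates. [folklore] -/
theorem coords_probe (j l : ℤ) (w : ℂ) (u : energySpace (Fin 3)) : (probe j l w).coords u = probeCoords u :=
  rfl

/-! ## Values along the orbit -/

/-- `⟪v(y), e₁⟫ = v₁(y)`. [folklore] -/
theorem inner_vfield_e1v (y : 𝕋³) : ⟪vfield y, e1v⟫_ℝ = V1 y := by
  simp [e1v, vfield, EuclideanSpace.inner_single_right, inner_add_left]

/-- The complex probe amplitude `Z_k(σ) = ∫ e_k(x) v₁(x + hvec σ) dx`. [folklore] -/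
def Zk (k : Fin 3 → ℤ) (σ : 𝕋²) : ℂ := ∫ x, mFourier k x * (V1 (x + hvec σ) : ℂ)

/-- `Z_k(σ) = e_{-k}(hvec σ) 𝓕v₁(-k)` (Fourier coefficients of a translate). [folklore] -/
theorem Zk_eq (k : Fin 3 → ℤ) (σ : 𝕋²) :
    Zk k σ = mFourier (-k) (hvec σ) * mFourierCoeff (fun x : 𝕋³ => (V1 x : ℂ)) (-k) := by
  have h := mFourierCoeff_comp_add_right (fun x : 𝕋³ => (V1 x : ℂ)) (hvec σ) (-k)
  rw [mFourierCoeff_eq_integral_volume, neg_neg] at h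
  simp only [smul_eq_mul] at h
  rw [Zk, h]

/-- The integrand of `Z_k` is integrable. [folklore] -/
theorem integrable_Zk (k : Fin 3 → ℤ) (σ : 𝕋²) :
    Integrable (fun x : 𝕋³ => mFourier k x * (V1 (x + hvec σ) : ℂ)) volume :=
  ((mFourier k).continuous.mul (Complex.continuous_ofReal.comp
    (isSmooth_V1.continuous.comp (continuous_add_const _)))).integrable_unitAddTorus

/-- The probe pairings along the orbit are the real / imaginary parts of `Z_k`. [folklore] -/
theorem pairing_orb_stokesMode (k : Fin 3 → ℤ) (c : Bool) (σ : 𝕋²) :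
    pairing ((orb σ : Lp E³ 2 (volume : Measure 𝕋³))) (⇑(stokesMode k e1v c)) =
      if c then (Zk k σ).re else (Zk k σ).im := by
  unfold pairing
  rw [integral_inner_orb]
  have e : ∀ x, ⟪vfield (x + hvec σ), stokesMode k e1v c x⟫_ℝ =
      if c then (mFourier k x * (V1 (x + hvec σ) : ℂ)).re else (mFourier k x * (V1 (x + hvec σ) : ℂ)).im := by
    intro x
    rw [stokesMode_apply, real_inner_smul_right, inner_vfield_e1v]
    cases c <;> simp [Complex.mul_re, Complex.mul_im, mul_comm]
  simp_rw [e]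
  cases c
  · simpa [Zk] using integral_im (integrable_Zk k σ)
  · simpa [Zk] using integral_re (integrable_Zk k σ)

/-- Characters of horizontal frequencies along `hvec`. [folklore] -/
theorem mFourier_hvec (a b : ℤ) (σ : 𝕋²) :
    mFourier (![a, 0, b] : Fin 3 → ℤ) (hvec σ) = mFourier (![a, b] : Fin 2 → ℤ) σ := by
  simp [mFourier, Fin.prod_univ_three, Fin.prod_univ_two, hvec]

/-- `Z_{kA}(σ) = ½ e_{(2,0)}(σ)`. [folklore] -/
theorem Zk_kA (σ : 𝕋²) : Zk kA σ = ((1 / 2 : ℝ) : ℂ) * mFourier (![2, 0] : Fin 2 → ℤ) σ := by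
  rw [Zk_eq, neg_kA, mFourierCoeff_V1_two, mFourier_hvec]
  push_cast
  ring

/-- `Z_{kB}(σ) = (c_K/4) e_{(0,1)}(σ)`. [folklore] -/
theorem Zk_kB (σ : 𝕋²) : Zk kB σ = ((cK / 4 : ℝ) : ℂ) * mFourier (![0, 1] : Fin 2 → ℤ) σ := by
  rw [Zk_eq, neg_kB, mFourierCoeff_V1_one, mFourier_hvec]
  push_cast
  ring

/-- The first complex probe coordinate along the orbit: `q₀ + i q₁ = ½ e_{(2,0)}(σ)`. [folklore] -/
theorem probeCoords_orb_01 (σ : 𝕋²) :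
    ((probeCoords (orb σ)) 0 : ℂ) + ((probeCoords (orb σ)) 1 : ℂ) * Complex.I =
      ((1 / 2 : ℝ) : ℂ) * mFourier (![2, 0] : Fin 2 → ℤ) σ := by
  have h0 : (probeCoords (orb σ)) 0 = (Zk kA σ).re := by
    simp [probeCoords, probeField, probeK, probeC, pairing_orb_stokesMode]
  have h1 : (probeCoords (orb σ)) 1 = (Zk kA σ).im := by
    simp [probeCoords, probeField, probeK, probeC, pairing_orb_stokesMode]
  rw [h0, h1, Complex.re_add_im, Zk_kA]

/-- The second complex probe coordinate along the orbit: `q₂ + i q₃ = (c_K/4) e_{(0,1)}(σ)`. [folklore] -/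
theorem probeCoords_orb_23 (σ : 𝕋²) :
    ((probeCoords (orb σ)) 2 : ℂ) + ((probeCoords (orb σ)) 3 : ℂ) * Complex.I =
      ((cK / 4 : ℝ) : ℂ) * mFourier (![0, 1] : Fin 2 → ℤ) σ := by
  have h2 : (probeCoords (orb σ)) 2 = (Zk kB σ).re := by
    simp [probeCoords, probeField, probeK, probeC, pairing_orb_stokesMode]
  have h3 : (probeCoords (orb σ)) 3 = (Zk kB σ).im := by
    simp [probeCoords, probeField, probeK, probeC, pairing_orb_stokesMode]
  rw [h2, h3, Complex.re_add_im, Zk_kB]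

/-- Powers of characters: `e_{n•p} = e_p^n`. [folklore] -/
theorem mFourier_nsmul (n : ℕ) (p : Fin 2 → ℤ) (σ : 𝕋²) : mFourier (n • p) σ = mFourier p σ ^ n := by
  induction n with
  | zero => simp [UnitAddTorus.mFourier_zero]
  | succ n ih => rw [succ_nsmul, UnitAddTorus.mFourier_add, ih, pow_succ]

/-- Signed powers of `r e_p(σ)`: `(r e_p)^{[n]} = r^{|n|} e_{n•p}` (`r` real). [folklore] -/
theorem spow_ofReal_mul_mFourier (r : ℝ) (p : Fin 2 → ℤ) (σ : 𝕋²) (n : ℤ) :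
    spow ((r : ℂ) * mFourier p σ) n = ((r ^ n.natAbs : ℝ) : ℂ) * mFourier (n • p) σ := by
  unfold spow
  split_ifs with hn
  · have e : n • p = n.natAbs • p := by
      rw [← natCast_zsmul, Int.natCast_natAbs, abs_of_nonneg hn]
    rw [mul_pow, ← mFourier_nsmul, e]
    push_cast
    rfl
  · have hn' : n ≤ 0 := le_of_lt (not_le.1 hn)
    have e : n • p = n.natAbs • (-p) := by
      rw [← natCast_zsmul, Int.ofNat_natAbs_of_nonpos hn', smul_neg, neg_smul, neg_neg]
    rw [map_mul, Complex.conj_ofReal, ← UnitAddTorus.mFourier_neg, mul_pow, ← mFourier_nsmul, e]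
    push_cast
    rfl

/-- The orbit amplitude `Γ_{j,l} = 2^{-|j|} (c_K/4)^{|l|}`. [folklore] -/
def Gam (j l : ℤ) : ℝ := (1 / 2 : ℝ) ^ j.natAbs * (cK / 4) ^ l.natAbs

/-- `c_K ≠ 0`. [folklore] -/
theorem cK_ne_zero : cK ≠ 0 := by
  intro h
  have := four_pi_mul_cK
  rw [h, mul_zero] at this
  norm_num at this

/-- `Γ_{j,l} ≠ 0`. [folklore] -/
theorem Gam_ne_zero (j l : ℤ) : Gam j l ≠ 0 :=
  mul_ne_zero (pow_ne_zero _ (by norm_num)) (pow_ne_zero _ (div_ne_zero cK_ne_zero (by norm_num)))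

/-- The probed planar frequency `(2j, l)`. [folklore] -/
def Pfreq (j l : ℤ) : Fin 2 → ℤ := ![2 * j, l]

/-- `(2j, l) = j•(2,0) + l•(0,1)`. [folklore] -/
theorem Pfreq_eq (j l : ℤ) : Pfreq j l = j • (![2, 0] : Fin 2 → ℤ) + l • (![0, 1] : Fin 2 → ℤ) := by
  ext i
  fin_cases i <;> simp [Pfreq, mul_comm]

/-- **The probe polynomial along the orbit is a character**: `G_{j,l}(coords(orb σ)) = Γ_{j,l} e_{(2j,l)}(σ)`. [folklore] -/
theorem Gpoly_probeCoords_orb (j l : ℤ) (σ : 𝕋²) :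
    Gpoly j l (probeCoords (orb σ)) = (Gam j l : ℂ) * mFourier (Pfreq j l) σ := by
  unfold Gpoly
  rw [probeCoords_orb_01, probeCoords_orb_23, spow_ofReal_mul_mFourier, spow_ofReal_mul_mFourier,
    Pfreq_eq, UnitAddTorus.mFourier_add]
  unfold Gam
  push_cast
  ring

/-- **The probe functional along the orbit**: `Φ_{j,l,w}(orb σ) = Re(w Γ_{j,l} e_{(2j,l)}(σ))`. [folklore] -/
theorem eval_probe_orb (j l : ℤ) (w : ℂ) (σ : 𝕋²) :
    (probe j l w).eval (orb σ) = (w * ((Gam j l : ℂ) * mFourier (Pfreq j l) σ)).re := by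
  show probeFun j l w ((probe j l w).coords (orb σ)) = _
  rw [coords_probe, probeFun, cutoff_probeCoords_orb, one_mul, Gpoly_probeCoords_orb]

/-! ## The drift pairing of the probe functionals along the orbit -/

/-- The phase `θ(p, y) = ∑ᵢ pᵢ yᵢ`. [folklore] -/
def theta (p : Fin 2 → ℤ) (y : E²) : ℝ := ∑ i, (p i : ℝ) * y i

/-- Characters at projected points: `e_p(proj y) = exp(2πi θ(p,y))`. [folklore] -/
theorem mFourier_proj (p : Fin 2 → ℤ) (y : E²) :
    mFourier p (proj y) = Complex.exp (2 * π * Complex.I * (theta p y : ℝ)) := by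
  simp only [mFourier, ContinuousMap.coe_mk, Fin.prod_univ_two, proj_apply, fourier_coe_apply, theta,
    Fin.sum_univ_two, ← Complex.exp_add]
  congr 1
  push_cast
  ring

/-- Along a horizontal line the probe functional is `t ↦ Re(w Γ e_P(σ) exp(2πi t θ))`. [folklore] -/
theorem eval_probe_orb_line (j l : ℤ) (w : ℂ) (h : E³) (σ : 𝕋²) (t : ℝ) :
    (probe j l w).eval (orb (σ + proj (t • hbar h))) =
      (w * ((Gam j l : ℂ) * mFourier (Pfreq j l) σ) *
        Complex.exp ((t : ℂ) * (2 * π * Complex.I * (theta (Pfreq j l) (hbar h) : ℝ)))).re := by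
  rw [eval_probe_orb, mFourier_apply_add, mFourier_proj]
  have e : theta (Pfreq j l) (t • hbar h) = t * theta (Pfreq j l) (hbar h) := by
    simp only [theta, PiLp.smul_apply, smul_eq_mul, Finset.mul_sum]
    refine Finset.sum_congr rfl fun i _ => ?_
    ring
  rw [e]
  congr 1
  push_cast
  ring

/-- The `t`-derivative at `0` of the probe functional along a horizontal line. [folklore] -/
theorem hasDerivAt_eval_probe_line (j l : ℤ) (w : ℂ) (h : E³) (σ : 𝕋²) :
    HasDerivAt (fun t : ℝ => (probe j l w).eval (orb (σ + proj (t • hbar h))))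
      ((w * ((Gam j l : ℂ) * mFourier (Pfreq j l) σ) *
        (2 * π * Complex.I * (theta (Pfreq j l) (hbar h) : ℝ))).re) 0 := by
  set A : ℂ := w * ((Gam j l : ℂ) * mFourier (Pfreq j l) σ) with hA
  set c : ℂ := 2 * π * Complex.I * (theta (Pfreq j l) (hbar h) : ℝ) with hc
  have h1 : HasDerivAt (fun t : ℝ => (t : ℂ) * c) c 0 := by
    simpa using (Complex.ofRealCLM.hasDerivAt (x := (0 : ℝ))).mul_const c
  have h2 : HasDerivAt (fun t : ℝ => A * Complex.exp ((t : ℂ) * c)) (A * c) 0 := by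
    simpa using h1.cexp.const_mul A
  have h3 : HasDerivAt (⇑Complex.reCLM ∘ fun t : ℝ => A * Complex.exp ((t : ℂ) * c))
      (Complex.reCLM (A * c)) 0 :=
    Complex.reCLM.hasFDerivAt.comp_hasDerivAt (0 : ℝ) h2
  refine h3.congr_of_eventuallyEq (Filter.Eventually.of_forall fun t => ?_)
  simp only [Function.comp_apply, Complex.reCLM_apply]
  exact eval_probe_orb_line j l w h σ t

/-- **Drift pairing of the probe functionals along the orbit**: for horizontal `h`,
`(orb σ, (h·∇)Φ'_{j,l,w}(orb σ)) = -Re(w Γ_{j,l} e_{(2j,l)}(σ) · 2πi θ((2j,l), h̄))`. [folklore] -/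
theorem driftTerm_probe_orb (j l : ℤ) (w : ℂ) {h : E³} (hh : h 1 = 0) (σ : 𝕋²) :
    driftTerm h (probe j l w) (orb σ) =
      -((w * ((Gam j l : ℂ) * mFourier (Pfreq j l) σ) *
        (2 * π * Complex.I * (theta (Pfreq j l) (hbar h) : ℝ))).re) := by
  have h1 := hasDerivAt_eval_orb_line (probe j l w) hh σ 0
  have h2 := hasDerivAt_eval_probe_line j l w h σ
  have e := h1.unique h2
  simp only [zero_smul, proj_zero, add_zero] at e
  linarith

end Summit.AnomalousDissipation.AnomalousDissipation.Theorems.CrossedShearOrbit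

end
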